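import Summits.HodgeConjecture.HodgeConjecture.Theorems.K2E4ArchGPrimeDefs            -- ★ p855236 (this seat): the `G′`-package objects
import Literature.NumberTheory.Rogawski1990.ArchStableOrbitalWallPackageOfClause    -- ★ (D0-2): brings ★ (R1-e-pkg) `isFiniteMeasureOnCompacts_and_sigmaFinite_map_conj_of_injective`, the wall-measure Radon tools
import HarnessLib

/-!
# The `G′`-package, bookkeeping: update ∕ insert laws of the 2-block data and of the state measures, and their Radon property (Rogawski 1990 §8.2 pp. 122–124, §14.5 p. 238)

Track B ∕ K2-LIT, crux h413 = `stmt-HodgeConjecture-24833`; prover seat `hodgecm-mathlib-K2E4-p11` (g0), V2 «G′ PACKAGE» for the assembler K2E4-p09 (`--supports … --as helper`).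
Pure bookkeeping over ★ `K2E4ArchGPrimeDefs` for the (step) and (end) files:
* §1 `twoBlock_update` ∕ `twoBlock_insert` ∕ `twoBlock_update_apply_of_ne` ∕ `datum_update_curve` ∕ `twoBlock_univ` — moving the 2-block datum at one place is a `Function.update`;
  freezing a place is the update by the centre `(σe₁, σe₁)`; along the central curve the 3-slot datum at the moving place is the (U)-road curve `z⁰_w · e^{i(ψ, 0, −ψ)}`.
* §2 `wallMeasure_of_pos` ∕ `wallMeasure_of_not_pos`, **`stateMeasure_update_curve`** (F1), **`stateMeasure_insert`** (F2), `stateMeasure_univ` — the state measures move by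
  `Function.update` at the moving place (the shape ★ G3-step `K2E4ArchGStateStep.tendsto_deriv_gState_step` consumes).
* §3 `isFiniteMeasureOnCompacts_and_sigmaFinite_wallMeasure` ∕ `…_stateMeasure_of_not_mem` — the wall measures (compact: proper orbit map ★ `isCompact_setOf_conj_circleDiagonal_comp_perm_mem_of_compactWall`;
  noncompact: closed orbit ★ `isClosed_conjClass_archLocal_of_mul_sub_eq_zero` + ★ `isFiniteMeasureOnCompacts_map_map_descConj_id`, the (R1-e-pkg) argument verbatim) and the regular
  orbit measures (★ `isFiniteMeasureOnCompacts_and_sigmaFinite_map_conj_of_injective`) are Radon and σ-finite.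
HONEST LABEL: HC_CM is proved only modulo the 7 printed citations (2 remaining named inputs: hLiu418 = `stmt-HodgeConjecture-24832`, h413 = `stmt-HodgeConjecture-24833`) until rung 0
closes; bookkeeping, pays nothing by itself.

## References
* [Rogawski1990] J. D. Rogawski, *Automorphic Representations of Unitary Groups in Three Variables*, Ann. of Math. Stud. 123 (1990), §8.2 pp. 122–124; §14.5 Lemma 14.5.2 (b) p. 238.
* [DeitmarEchterhoff2014] A. Deitmar, S. Echterhoff, *Principles of Harmonic Analysis*, 2nd ed. (2014), Lemma 9.3.3, Thm. 1.5.3.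
-/

set_option autoImplicit false
set_option linter.dupNamespace false  -- the cell's namespace convention `Summit.HodgeConjecture.HodgeConjecture.Cruxes.H413.<File>` repeats the summit = problem name

noncomputable section

open MeasureTheory Measure Filter Topology NumberField NumberField.InfinitePlace NumberField.mixedEmbedding Equiv Function Set
open Literature.MeasureTheory.Group Literature.NumberTheory.Automorphic Literature.NumberTheory.Automorphic.UnitaryGroup
open Literature.LinearAlgebra.Matrix Literature.NumberTheory.Rogawski1990
open Summit.HodgeConjecture.HodgeConjecture.Cruxes.H413.K2E4ArchGPrimeDefs
open scoped Matrix MatrixGroups Matrix.Norms.Operator ContDiff ENNReal Classical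

namespace Summit.HodgeConjecture.HodgeConjecture.Cruxes.H413.K2E4ArchGPrimeLemmas

variable (L : Type) [Field L] [NumberField L] [IsCMField L]

/-! ## §1 The 2-block data -/

section Data

variable (e₁ e₂ : L) (h₁ : (IsCMField.complexConj L e₁ : L) * e₁ = 1) (h₂ : (IsCMField.complexConj L e₂ : L) * e₂ = 1)

/-- Moving the datum at an UNPROCESSED place `w ∉ S` is a `Function.update` of the frozen datum. [cite: Rogawski1990, §14.5 p. 238] -/
theorem twoBlock_update (S : Finset {w : InfinitePlace L // IsComplex w}) (u : {w : InfinitePlace L // IsComplex w} → Fin 2 → Circle)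
    {w : {w : InfinitePlace L // IsComplex w}} (hw : w ∉ S) (x : Fin 2 → Circle) :
    twoBlock L e₁ h₁ S (Function.update u w x) = Function.update (twoBlock L e₁ h₁ S u) w x := by
  funext v
  by_cases hv : v = w
  · subst hv
    simp only [twoBlock, Function.update_self, if_neg hw]
  · simp only [twoBlock, Function.update_of_ne hv]

/-- Off the moving place the frozen datum does not see the update. [cite: Rogawski1990, §14.5 p. 238] -/
theorem twoBlock_update_apply_of_ne (S : Finset {w : InfinitePlace L // IsComplex w}) (u : {w : InfinitePlace L // IsComplex w} → Fin 2 → Circle)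
    {w v : {w : InfinitePlace L // IsComplex w}} (hv : v ≠ w) (x : Fin 2 → Circle) :
    twoBlock L e₁ h₁ S (Function.update u w x) v = twoBlock L e₁ h₁ S u v := by
  simp only [twoBlock, Function.update_of_ne hv]

/-- Freezing the place `w` is the update by the centre `(σe₁, σe₁)`. [cite: Rogawski1990, §14.5 p. 238] -/
theorem twoBlock_insert (S : Finset {w : InfinitePlace L // IsComplex w}) (u : {w : InfinitePlace L // IsComplex w} → Fin 2 → Circle)
    (w : {w : InfinitePlace L // IsComplex w}) :
    twoBlock L e₁ h₁ (insert w S) u = Function.update (twoBlock L e₁ h₁ S u) w ![embCircle L e₁ h₁ w, embCircle L e₁ h₁ w] := by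
  funext v
  by_cases hv : v = w
  · subst hv
    simp only [twoBlock, Function.update_self, Finset.mem_insert_self, if_true]
  · simp only [twoBlock, Function.update_of_ne hv, Finset.mem_insert, hv, false_or]

/-- With every place frozen the 2-block datum is the centre everywhere. [cite: Rogawski1990, §14.5 p. 238] -/
theorem twoBlock_univ (u : {w : InfinitePlace L // IsComplex w} → Fin 2 → Circle) :
    twoBlock L e₁ h₁ Finset.univ u = fun v => ![embCircle L e₁ h₁ v, embCircle L e₁ h₁ v] := by
  funext v
  simp [twoBlock]

/-- With every place frozen the 3-slot datum is the wall point everywhere. [cite: Rogawski1990, §8.2 p. 118] -/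
theorem datum_univ (u : {w : InfinitePlace L // IsComplex w} → Fin 2 → Circle) :
    datum L e₁ e₂ h₁ h₂ Finset.univ u = wallPoint L e₁ e₂ h₁ h₂ := by
  funext v
  simp [datum, twoBlock, wallPoint]

/-- **Along the central curve at `w ∉ S` the 3-slot datum at `w` is the (U)-road curve `i ↦ z⁰_{w,i} · e^{i(1,0,−1)_i ψ}`.** [cite: Rogawski1990, §8.2 p. 119 (`γ = γ(ψ)`)] -/
theorem datum_update_curve (S : Finset {w : InfinitePlace L // IsComplex w}) (u : {w : InfinitePlace L // IsComplex w} → Fin 2 → Circle)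
    {w : {w : InfinitePlace L // IsComplex w}} (hw : w ∉ S) (ψ : ℝ) :
    datum L e₁ e₂ h₁ h₂ S (Function.update u w ![embCircle L e₁ h₁ w * Circle.exp ψ, embCircle L e₁ h₁ w * Circle.exp (-ψ)]) w =
      fun i => wallPoint L e₁ e₂ h₁ h₂ w i * Circle.exp (![(1 : ℝ), 0, -1] i * ψ) := by
  funext i
  simp only [datum, twoBlock_update L e₁ h₁ S u hw, Function.update_self]
  fin_cases i <;> simp

/-- Off the moving place the 3-slot datum does not see the update. [cite: Rogawski1990, §14.5 p. 238] -/
theorem datum_update_apply_of_ne (S : Finset {w : InfinitePlace L // IsComplex w}) (u : {w : InfinitePlace L // IsComplex w} → Fin 2 → Circle)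
    {w v : {w : InfinitePlace L // IsComplex w}} (hv : v ≠ w) (x : Fin 2 → Circle) :
    datum L e₁ e₂ h₁ h₂ S (Function.update u w x) v = datum L e₁ e₂ h₁ h₂ S u v := by
  simp only [datum, twoBlock_update_apply_of_ne L e₁ h₁ S u hv]

/-- After freezing `w`, the datum at `w` is the wall point; elsewhere it is unchanged. [cite: Rogawski1990, §14.5 p. 238] -/
theorem datum_insert_apply (S : Finset {w : InfinitePlace L // IsComplex w}) (u : {w : InfinitePlace L // IsComplex w} → Fin 2 → Circle)
    (w v : {w : InfinitePlace L // IsComplex w}) :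
    datum L e₁ e₂ h₁ h₂ (insert w S) u v = if v = w then wallPoint L e₁ e₂ h₁ h₂ v else datum L e₁ e₂ h₁ h₂ S u v := by
  by_cases hv : v = w
  · subst hv
    simp only [datum, twoBlock_insert, Function.update_self, Matrix.cons_val_zero, Matrix.cons_val_one, if_true]
  · simp only [datum, twoBlock_insert, Function.update_of_ne hv, if_neg hv]

end Data

/-! ## §2 The measures -/

section Measures

variable (α : Fin 3 → L) [MeasurableSpace (GL (Fin 3) ℂ)] [BorelSpace (GL (Fin 3) ℂ)]
  (νw : ∀ v : {w : InfinitePlace L // IsComplex w}, Measure (archLocal L 3 (Matrix.diagonal α) v)) (hνw : ∀ v, (νw v).IsHaarMeasure ∧ (νw v).IsMulRightInvariant)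
  (e₁ e₂ : L) (h₁ : (IsCMField.complexConj L e₁ : L) * e₁ = 1) (h₂ : (IsCMField.complexConj L e₂ : L) * e₂ = 1) (hne : e₁ ≠ e₂)
  [∀ (w : {w : InfinitePlace L // IsComplex w}) (τ : Perm (Fin 3)), MeasurableSpace (archLocal L 3 (Matrix.diagonal (α ∘ ⇑τ)) w ⧸ Subgroup.centralizer
    ({(⟨circleDiagonal 3 (wallPoint L e₁ e₂ h₁ h₂ w), circleDiagonal_mem_archLocal_diagonal L 3 (α ∘ ⇑τ) w (wallPoint L e₁ e₂ h₁ h₂ w)⟩ : archLocal L 3 (Matrix.diagonal (α ∘ ⇑τ)) w)} :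
      Set (archLocal L 3 (Matrix.diagonal (α ∘ ⇑τ)) w)))]
  [∀ (w : {w : InfinitePlace L // IsComplex w}) (τ : Perm (Fin 3)), BorelSpace (archLocal L 3 (Matrix.diagonal (α ∘ ⇑τ)) w ⧸ Subgroup.centralizer
    ({(⟨circleDiagonal 3 (wallPoint L e₁ e₂ h₁ h₂ w), circleDiagonal_mem_archLocal_diagonal L 3 (α ∘ ⇑τ) w (wallPoint L e₁ e₂ h₁ h₂ w)⟩ : archLocal L 3 (Matrix.diagonal (α ∘ ⇑τ)) w)} :
      Set (archLocal L 3 (Matrix.diagonal (α ∘ ⇑τ)) w)))]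
  (νH : ∀ (w : {w : InfinitePlace L // IsComplex w}) (τ : Perm (Fin 3)), Measure (Subgroup.centralizer
    ({(⟨circleDiagonal 3 (wallPoint L e₁ e₂ h₁ h₂ w), circleDiagonal_mem_archLocal_diagonal L 3 (α ∘ ⇑τ) w (wallPoint L e₁ e₂ h₁ h₂ w)⟩ : archLocal L 3 (Matrix.diagonal (α ∘ ⇑τ)) w)} :
      Set (archLocal L 3 (Matrix.diagonal (α ∘ ⇑τ)) w))))
  (hνH : ∀ w τ, (νH w τ).IsHaarMeasure ∧ (νH w τ).IsInvInvariant)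

/-- The wall measure of a COMPACT partner is the finite orbit measure. [cite: Rogawski1990, §8.2 p. 123] -/
theorem wallMeasure_of_pos (w : {w : InfinitePlace L // IsComplex w}) (τ : Perm (Fin 3)) (h : 0 < (w.1.embedding (α (τ⁻¹ 0))).re * (w.1.embedding (α (τ⁻¹ 2))).re) :
    wallMeasure L α νw hνw e₁ e₂ h₁ h₂ hne νH hνH w τ = (νw w).map fun y : archLocal L 3 (Matrix.diagonal α) w =>
      y * (⟨circleDiagonal 3 (wallPoint L e₁ e₂ h₁ h₂ w ∘ ⇑τ), circleDiagonal_mem_archLocal_diagonal L 3 α w (wallPoint L e₁ e₂ h₁ h₂ w ∘ ⇑τ)⟩ : archLocal L 3 (Matrix.diagonal α) w) * y⁻¹ := by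
  simp only [wallMeasure, if_pos h]

/-- The wall measure of a NONCOMPACT partner is the singular orbit measure. [cite: Rogawski1990, §8.2 p. 124] -/
theorem wallMeasure_of_not_pos (w : {w : InfinitePlace L // IsComplex w}) (τ : Perm (Fin 3)) (h : ¬ 0 < (w.1.embedding (α (τ⁻¹ 0))).re * (w.1.embedding (α (τ⁻¹ 2))).re) :
    wallMeasure L α νw hνw e₁ e₂ h₁ h₂ hne νH hνH w τ = singularWallMeasure L α νw hνw e₁ e₂ h₁ h₂ hne νH hνH w τ := by
  simp only [wallMeasure, if_neg h]

/-- **(F1) Along the central curve at `w ∉ S` the state measures are the `Function.update` at `w` by the regular orbit measure of the curve point** (the shape of ★ G3-step's `hB`).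
[cite: Rogawski1990, §8.2 p. 124; §14.5 p. 238] -/
theorem stateMeasure_update_curve (S : Finset {w : InfinitePlace L // IsComplex w}) (u : {w : InfinitePlace L // IsComplex w} → Fin 2 → Circle)
    {w : {w : InfinitePlace L // IsComplex w}} (hw : w ∉ S) (ψ : ℝ) (ρ : {w : InfinitePlace L // IsComplex w} → Perm (Fin 3)) :
    stateMeasure L α νw hνw e₁ e₂ h₁ h₂ hne νH hνH S (Function.update u w ![embCircle L e₁ h₁ w * Circle.exp ψ, embCircle L e₁ h₁ w * Circle.exp (-ψ)]) ρ =
      Function.update (stateMeasure L α νw hνw e₁ e₂ h₁ h₂ hne νH hνH S u ρ) w ((νw w).map fun y : archLocal L 3 (Matrix.diagonal α) w =>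
        y * (⟨circleDiagonal 3 ((fun i => wallPoint L e₁ e₂ h₁ h₂ w i * Circle.exp (![(1 : ℝ), 0, -1] i * ψ)) ∘ ⇑(ρ w)),
          circleDiagonal_mem_archLocal_diagonal L 3 α w ((fun i => wallPoint L e₁ e₂ h₁ h₂ w i * Circle.exp (![(1 : ℝ), 0, -1] i * ψ)) ∘ ⇑(ρ w))⟩ : archLocal L 3 (Matrix.diagonal α) w) * y⁻¹) := by
  funext v
  by_cases hv : v = w
  · subst hv
    rw [Function.update_self]
    simp only [stateMeasure, if_neg hw, datum_update_curve L e₁ e₂ h₁ h₂ S u hw ψ]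
  · rw [Function.update_of_ne hv]
    simp only [stateMeasure, datum_update_apply_of_ne L e₁ e₂ h₁ h₂ S u hv]

/-- **(F2) Freezing `w ∉ S` updates the state measures at `w` by the wall measure of the partner `ρ_w`.** [cite: Rogawski1990, §8.2 p. 124; §14.5 p. 238] -/
theorem stateMeasure_insert (S : Finset {w : InfinitePlace L // IsComplex w}) (u : {w : InfinitePlace L // IsComplex w} → Fin 2 → Circle)
    {w : {w : InfinitePlace L // IsComplex w}} (hw : w ∉ S) (ρ : {w : InfinitePlace L // IsComplex w} → Perm (Fin 3)) :
    stateMeasure L α νw hνw e₁ e₂ h₁ h₂ hne νH hνH (insert w S) u ρ =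
      Function.update (stateMeasure L α νw hνw e₁ e₂ h₁ h₂ hne νH hνH S u ρ) w (wallMeasure L α νw hνw e₁ e₂ h₁ h₂ hne νH hνH w (ρ w)) := by
  funext v
  by_cases hv : v = w
  · subst hv
    rw [Function.update_self]
    simp only [stateMeasure, Finset.mem_insert_self, if_true]
  · rw [Function.update_of_ne hv]
    have hmem : (v ∈ insert w S) = (v ∈ S) := by rw [Finset.mem_insert, eq_iff_iff, or_iff_right hv]
    simp only [stateMeasure, hmem, datum_insert_apply L e₁ e₂ h₁ h₂ S u w v, if_neg hv]

/-- With every place frozen the state measures are the wall measures. [cite: Rogawski1990, §8.2 p. 124] -/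
theorem stateMeasure_univ (u : {w : InfinitePlace L // IsComplex w} → Fin 2 → Circle) (ρ : {w : InfinitePlace L // IsComplex w} → Perm (Fin 3)) :
    stateMeasure L α νw hνw e₁ e₂ h₁ h₂ hne νH hνH Finset.univ u ρ = fun v => wallMeasure L α νw hνw e₁ e₂ h₁ h₂ hne νH hνH v (ρ v) := by
  funext v
  simp [stateMeasure]

/-! ## §3 Radon -/

/-- **THE WALL MEASURES ARE RADON AND σ-FINITE** (compact partner: the orbit map of a compact-centraliser point is proper; noncompact partner: the singular orbit is closed and the Weil
quotient is locally finite — the (R1-e-pkg) argument). [cite: Rogawski1990, §8.2 pp. 123–124] [cite: DeitmarEchterhoff2014, Lemma 9.3.3, Thm. 1.5.3] -/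
theorem isFiniteMeasureOnCompacts_and_sigmaFinite_wallMeasure (hα : ∀ i, α i ≠ 0) (hherm : ∀ i, (IsCMField.complexConj L (α i) : L) = α i)
    (v : {w : InfinitePlace L // IsComplex w}) (τ : Perm (Fin 3)) :
    IsFiniteMeasureOnCompacts (wallMeasure L α νw hνw e₁ e₂ h₁ h₂ hne νH hνH v τ) ∧ SigmaFinite (wallMeasure L α νw hνw e₁ e₂ h₁ h₂ hne νH hνH v τ) := by
  classical
  haveI : ∀ v : {w : InfinitePlace L // IsComplex w}, LocallyCompactSpace (archLocal L 3 (Matrix.diagonal α) v) := fun v => locallyCompactSpace_archLocal L 3 (Matrix.diagonal α) v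
  haveI : ∀ v : {w : InfinitePlace L // IsComplex w}, SecondCountableTopology (archLocal L 3 (Matrix.diagonal α) v) := fun v => secondCountableTopology_archLocal L 3 (Matrix.diagonal α) v
  haveI : ∀ σ' : Perm (Fin 3), LocallyCompactSpace (archLocal L 3 (Matrix.diagonal (α ∘ ⇑σ')) v) := fun σ' => locallyCompactSpace_archLocal L 3 (Matrix.diagonal (α ∘ ⇑σ')) v
  haveI : ∀ σ' : Perm (Fin 3), SecondCountableTopology (archLocal L 3 (Matrix.diagonal (α ∘ ⇑σ')) v) := fun σ' => secondCountableTopology_archLocal L 3 (Matrix.diagonal (α ∘ ⇑σ')) v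
  have hreal : ∀ i, (v.1.embedding (α i)).im = 0 := fun i => im_embedding_eq_zero_of_complexConj_eq L v (hherm i)
  have hwall := wallPoint_zero_eq_two L e₁ e₂ h₁ h₂ v
  have h01 := wallPoint_zero_ne_one L e₁ e₂ h₁ h₂ hne v
  by_cases hcw : 0 < (v.1.embedding (α (τ⁻¹ 0))).re * (v.1.embedding (α (τ⁻¹ 2))).re
  · rw [wallMeasure_of_pos L α νw hνw e₁ e₂ h₁ h₂ hne νH hνH v τ hcw]
    haveI : IsFiniteMeasureOnCompacts (νw v) := (hνw v).1.toIsFiniteMeasureOnCompacts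
    haveI hfc := isFiniteMeasureOnCompacts_map_conj_of_proper L 3 α v (νw v) _ fun C hC =>
      isCompact_setOf_conj_circleDiagonal_comp_perm_mem_of_compactWall L α v hα hreal (wallPoint L e₁ e₂ h₁ h₂ v) hwall h01 τ hcw C hC
    haveI hlf : IsLocallyFiniteMeasure ((νw v).map fun y : archLocal L 3 (Matrix.diagonal α) v =>
        y * (⟨circleDiagonal 3 (wallPoint L e₁ e₂ h₁ h₂ v ∘ ⇑τ), circleDiagonal_mem_archLocal_diagonal L 3 α v (wallPoint L e₁ e₂ h₁ h₂ v ∘ ⇑τ)⟩ : archLocal L 3 (Matrix.diagonal α) v) * y⁻¹) :=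
      isLocallyFiniteMeasure_of_isFiniteMeasureOnCompacts
    exact ⟨hfc, sigmaFinite_of_locallyFinite⟩
  · rw [wallMeasure_of_not_pos L α νw hνw e₁ e₂ h₁ h₂ hne νH hνH v τ hcw]
    unfold singularWallMeasure
    haveI := (hνH v τ⁻¹).1; haveI := (hνH v τ⁻¹).2; haveI := (hνw v).1; haveI := (hνw v).2
    haveI : ((νw v).map (ContinuousMulEquiv.restrictSubgroup (GLn.conjEquiv (Matrix.GeneralLinearGroup.mkOfDetNeZero _ (det_monomial_one_ne_zero 3 τ⁻¹)))
        (archLocal L 3 (Matrix.diagonal (α ∘ ⇑τ⁻¹)) v) (archLocal L 3 (Matrix.diagonal α) v)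
        (mem_archLocal_comp_perm_iff_conj_mem L 3 α v τ⁻¹)).symm).IsHaarMeasure := ContinuousMulEquiv.isHaarMeasure_map (νw v) _
    haveI : ((νw v).map (ContinuousMulEquiv.restrictSubgroup (GLn.conjEquiv (Matrix.GeneralLinearGroup.mkOfDetNeZero _ (det_monomial_one_ne_zero 3 τ⁻¹)))
        (archLocal L 3 (Matrix.diagonal (α ∘ ⇑τ⁻¹)) v) (archLocal L 3 (Matrix.diagonal α) v)
        (mem_archLocal_comp_perm_iff_conj_mem L 3 α v τ⁻¹)).symm).IsMulRightInvariant := isMulRightInvariant_map_relabel_symm L 3 α v τ⁻¹ (νw v)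
    have hdet : (Matrix.diagonal (α ∘ ⇑τ⁻¹)).det ≠ 0 := by
      rw [Matrix.det_diagonal]; exact Finset.prod_ne_zero_iff.mpr fun i _ => hα _
    have hab : ((wallPoint L e₁ e₂ h₁ h₂ v 0 : Circle) : ℂ) ≠ wallPoint L e₁ e₂ h₁ h₂ v 1 := fun h => h01 (Subtype.val_injective h)
    have hO := isClosed_conjClass_archLocal_of_mul_sub_eq_zero L 3 (Matrix.diagonal (α ∘ ⇑τ⁻¹)) v
      (map_cmConjRingHom_transpose_diagonal L (α ∘ ⇑τ⁻¹) fun i => hherm _) hdet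
      (⟨circleDiagonal 3 (wallPoint L e₁ e₂ h₁ h₂ v), circleDiagonal_mem_archLocal_diagonal L 3 (α ∘ ⇑τ⁻¹) v (wallPoint L e₁ e₂ h₁ h₂ v)⟩ : archLocal L 3 (Matrix.diagonal (α ∘ ⇑τ⁻¹)) v)
      hab (mul_sub_eq_zero_circleDiagonal_wall L (α ∘ ⇑τ⁻¹) v hwall)
    have hMeq := centralizer_circleDiagonal_eq_of_wall L (α ∘ ⇑τ⁻¹) v hwall h01 hwall h01
    haveI := isFiniteMeasureOnCompacts_map_map_descConj_id _ _
      (forall_mem_centralizer_circleDiagonal_comm_of_wall L (α ∘ ⇑τ⁻¹) v hwall h01 hwall h01) hO hMeq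
      (quotientMeasure _ (νH v τ⁻¹) (isClosed_coe_centralizer_singleton _)
        ((νw v).map (ContinuousMulEquiv.restrictSubgroup (GLn.conjEquiv (Matrix.GeneralLinearGroup.mkOfDetNeZero _ (det_monomial_one_ne_zero 3 τ⁻¹)))
          (archLocal L 3 (Matrix.diagonal (α ∘ ⇑τ⁻¹)) v) (archLocal L 3 (Matrix.diagonal α) v)
          (mem_archLocal_comp_perm_iff_conj_mem L 3 α v τ⁻¹)).symm))
      (ContinuousMulEquiv.restrictSubgroup (GLn.conjEquiv (Matrix.GeneralLinearGroup.mkOfDetNeZero _ (det_monomial_one_ne_zero 3 τ⁻¹)))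
            (archLocal L 3 (Matrix.diagonal (α ∘ ⇑τ⁻¹)) v) (archLocal L 3 (Matrix.diagonal α) v)
            (mem_archLocal_comp_perm_iff_conj_mem L 3 α v τ⁻¹))
    refine ⟨this, ?_⟩
    haveI hlf := @isLocallyFiniteMeasure_of_isFiniteMeasureOnCompacts _ _ _ _ _ this
    exact sigmaFinite_of_locallyFinite

/-- **OFF THE MOVING PLACE THE STATE MEASURES ARE RADON AND σ-FINITE**: wall measures on `S`, regular orbit measures (injective datum) off `S`.
[cite: Rogawski1990, §8.2 pp. 123–124; §14.5 p. 238] [cite: DeitmarEchterhoff2014, Lemma 9.3.3] -/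
theorem isFiniteMeasureOnCompacts_and_sigmaFinite_stateMeasure (hα : ∀ i, α i ≠ 0) (hherm : ∀ i, (IsCMField.complexConj L (α i) : L) = α i)
    (S : Finset {w : InfinitePlace L // IsComplex w}) (u : {w : InfinitePlace L // IsComplex w} → Fin 2 → Circle)
    (ρ : {w : InfinitePlace L // IsComplex w} → Perm (Fin 3)) (v : {w : InfinitePlace L // IsComplex w})
    (hv : v ∈ S ∨ (u v 0 ≠ u v 1 ∧ u v 0 ≠ embCircle L e₂ h₂ v ∧ u v 1 ≠ embCircle L e₂ h₂ v)) :
    IsFiniteMeasureOnCompacts (stateMeasure L α νw hνw e₁ e₂ h₁ h₂ hne νH hνH S u ρ v) ∧ SigmaFinite (stateMeasure L α νw hνw e₁ e₂ h₁ h₂ hne νH hνH S u ρ v) := by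
  by_cases hS : v ∈ S
  · simp only [stateMeasure, if_pos hS]
    exact isFiniteMeasureOnCompacts_and_sigmaFinite_wallMeasure L α νw hνw e₁ e₂ h₁ h₂ hne νH hνH hα hherm v (ρ v)
  · simp only [stateMeasure, if_neg hS]
    have hu := hv.resolve_left hS
    haveI : IsFiniteMeasureOnCompacts (νw v) := (hνw v).1.toIsFiniteMeasureOnCompacts
    have hinj : Function.Injective (datum L e₁ e₂ h₁ h₂ S u v ∘ ⇑(ρ v)) := by
      refine Function.Injective.comp ?_ (ρ v).injective
      have h3 : ∀ {X : Type} {a b c : X}, a ≠ b → a ≠ c → b ≠ c → Function.Injective (![a, b, c] : Fin 3 → X) := by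
        intro X a b c hab hac hbc i j h
        fin_cases i <;> fin_cases j <;> simp_all [eq_comm]
      simp only [datum, twoBlock, if_neg hS]
      exact h3 hu.2.1 hu.1 hu.2.2.symm
    exact isFiniteMeasureOnCompacts_and_sigmaFinite_map_conj_of_injective L α hα v (νw v) _ hinj

end Measures

end Summit.HodgeConjecture.HodgeConjecture.Cruxes.H413.K2E4ArchGPrimeLemmas

end
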